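import Summits.Langlands.Langlands.Theses.NonParallelVoid
import Summits.Langlands.Langlands.Theorems.WachComponentCensusPD2UnramReducible
import Summits.Langlands.Langlands.Theorems.TriangulineChamberLiftB2CrysSplitPCompletion
import Literature.NumberTheory.GaloisRepresentations.PstCrystallineExtensionData
import Literature.NumberTheory.GaloisRepresentations.PotentialDiagonalizabilityFontaineLaffaille
import Literature.NumberTheory.GaloisRepresentations.PotentialDiagonalizabilityGaoLiu
import Literature.NumberTheory.GaloisRepresentations.PstCrystallineExtensionDataFLRange
import Literature.NumberTheory.GaloisRepresentations.SplitsCompletelyCriteria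
import Literature.NumberTheory.Automorphic.HarrisLanTaylorThorneCor627Proofs
import Literature.NumberTheory.PAdicHodge.FontaineDpst

/-!
# Stub `stub_pdAtSplitPrime` of line `symmetrise-pd-split` (crux `stmt-Langlands-17000`,
# `NonParallelVoid.TwistedInductionParallel`) — what is provable now, and the registered stub 2-small (v4)

The registered stub asks, for `F` quadratic, `p ≥ 11` with two places above `p` (so `F_v = ℚ_p`),
`ρ : Γ_F → GL₂(ℚ̄_p)` crystalline at `v` for THE pinned datum `fontainePstAdicCompletion v p hv`
with two distinct labelled Hodge–Tate weights `{a, b}`, that `ρ|Γ_{F_v}` be potentially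
diagonalisable relative to EVERY compatible crystalline extension datum
`𝔈 : PstCrystallineExtensionData _` — with NO bound on the gap `b - a`.  That is the `K = ℚ_p`
slice of the open work item `stmt-Langlands-14643` (`PD2Unram`; first open instance
`stmt-Langlands-14523`, `V_{p+2,a_p}`, `0 < v(a_p) < 1`): Barnet-Lamb–Gee–Geraghty–Taylor's
printed open question (arXiv:1010.2561 p. 4 "Could every crystalline representation be potentially
diagonalizable? (We have no reason to believe this, but we know of no counterexample.)"; p. 14 "As
far as we know they could all be"), known in print only for an invariant line (Lemma 1.4.3 (1)),
Hodge–Tate gap `≤ p − 2` (Lemma 1.4.3 (2)), `≤ p − 1` (Gao–Liu 2014, Thm. 3.0.3, no residual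
hypothesis), `≤ p` under strong cyclotomic-freeness of `ρ̄` (Bartlett 2020, Thm. 74), and
potentially Barsotti–Tate; Bartlett–Le Hung–Levin 2026 (arXiv:2604.17466, §1 p. 3) confirm
nothing beyond for `n = 2`.  So the stub is NOT closed here, and nothing below restates it under
its name.  This file proves the sub-cases that ARE available, in the stub's exact shape:

* `pdAtSplitPrime_of_hasInvariantCompleteFlag`, `pdAtSplitPrime_of_not_isIrreducible` — the
  invariant-line sector (every weight, every `p`, every place, UNCONDITIONAL: BLGGT Lemma 1.4.3 (1)
  is proved in the tree, `blggt2014_lemma_1_4_3_1_holds`, and `[F_v : ℚ_p] < ∞` for the datum's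
  `ℚ_p`-structure is unconditional, `fontainePstAdicCompletion_algebra_eq_adicCompletionPadicAlgebra`);
* `pdAtSplitPrime_of_gap_le` — the registered signature VERBATIM plus the conjunct `b - a + 2 ≤ p`
  (gap `≤ p − 2`), CONDITIONAL on the tree's named fact `blggt2014_lemma_1_4_3_2`;
* `pdAtSplitPrime_of_gap_lt` — VERBATIM plus `b - a + 1 ≤ p` (gap `≤ p − 1`), CONDITIONAL on the
  named fact `gaoLiu2014_mainTheorem` (file `PotentialDiagonalizabilityGaoLiu`, p166867, landed
  for this stub);
  both through `pdAtSplitPrime_of_range` (interval of length `m`) and the landed bridge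
  `PstCrystallineExtensionData.isPotentiallyDiagonalizable_of_weightsInRange_of_surjective`
  (file `PstCrystallineExtensionDataFLRange`, p167058): over a degree-one base the `𝔇.𝔅`-weights
  `{a, b}` at the unique `ℚ_p`-embedding ARE the `(𝔈.𝔅 ⊥)`-weights the range facts read
  (`F₀ = ⊤`, base labels, `labelledHodgeTateWeights_bot_eq`; non-`ℚ_p`-linear labels carry none);
* the number-field bookkeeping `residueCard_eq_and_not_sq_dvd_of_two_places` (two places above
  `p` in a quadratic field ⇒ `f_v = e_v = 1`) and `algebraMap_fontainePst_surjective_of_two_places`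
  (⇒ `ℚ_p → F_v` onto for the datum's structure, via
  `LiftB2CrysSplitP.algebraMap_adicCompletion_surjective_of_split`).

What remains OPEN is exactly gap `b - a ≥ p` (`= p`: Bartlett 2020 needs `ρ̄` strongly
cyclotomic-free; `≥ p + 1`: no printed result) — see `StubPdAtSplitPrime-census.md`.
-/

noncomputable section

open scoped NumberField TensorProduct
open NumberField IsDedekindDomain Field Filter
open Literature.NumberTheory.GaloisRepresentations Literature.NumberTheory.PAdicHodge

set_option linter.dupNamespace false

namespace Summit.Langlands.Langlands.Cruxes.TwistedInductionParallel.SymmetrisePdSplit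


/-! ### 1. Two places above `p` in a quadratic field: `e_v = f_v = 1`, `F_v = ℚ_p` -/

section Split

variable {F : Type} [Field F] [NumberField F]

/-- `e(w ∣ p) = 1` for `p` unramified in `𝓞 F` means `𝔭_w² ∤ (p)`. [folklore] -/
theorem not_sq_dvd_span_of_isUnramifiedIn (w : HeightOneSpectrum (𝓞 F)) {p : ℕ} (hp : p.Prime)
    (hw : ((p : ℕ) : 𝓞 F) ∈ w.asIdeal)
    (hunr : Algebra.IsUnramifiedIn (𝓞 F) (Ideal.span {(p : ℤ)})) :
    ¬ w.asIdeal ^ 2 ∣ Ideal.span {((p : ℕ) : 𝓞 F)} := by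
  -- adapted from `natCast_not_mem_sq_of_isUnramifiedIn` (DegreeOnePlacesProofs), base `ℤ`
  classical
  haveI := w.isPrime
  haveI hover : w.asIdeal.LiesOver (Ideal.span {(p : ℤ)}) :=
    liesOver_span_of_natCast_mem_asIdeal hp w hw
  have hmap : (Ideal.span {(p : ℤ)}).map (algebraMap ℤ (𝓞 F)) = Ideal.span {((p : ℕ) : 𝓞 F)} := by
    rw [Ideal.map_span, Set.image_singleton, map_natCast]
  have hne : (Ideal.span {(p : ℤ)}).map (algebraMap ℤ (𝓞 F)) ≠ ⊥ := by
    rw [hmap, Ne, Ideal.span_singleton_eq_bot, Nat.cast_eq_zero]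
    exact hp.ne_zero
  have he : w.asIdeal.ramificationIdx ℤ = 1 := hunr.ramificationIdx_eq_one hover
  have hcount : (UniqueFactorizationMonoid.normalizedFactors
      (Ideal.span {((p : ℕ) : 𝓞 F)})).count w.asIdeal = 1 := by
    rw [← hmap, ← Ideal.IsDedekindDomain.ramificationIdx_eq_normalizedFactors_count
      (Ideal.span {(p : ℤ)}) w.asIdeal hne]
    exact he
  intro hdvd
  have hp0 : Ideal.span {((p : ℕ) : 𝓞 F)} ≠ 0 := by
    rw [← hmap]
    exact hne
  have h2 := pow_dvd_iff_le_emultiplicity.mp hdvd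
  rw [UniqueFactorizationMonoid.emultiplicity_eq_count_normalizedFactors w.irreducible hp0,
    normalize_eq, hcount] at h2
  norm_num at h2

/-- **Two places above `p` in a quadratic field force `f_v = 1` and `e_v = 1`**: there are then
exactly `2 = [F : ℚ]` primes above `p` (at most `[F : ℚ]` by `∑ e f = [F : ℚ]`), so `p` splits
completely (`splitsCompletely_of_ncard_primesOver_eq_two`). [folklore] -/
theorem residueCard_eq_and_not_sq_dvd_of_two_places [Algebra.IsQuadraticExtension ℚ F]
    {p : ℕ} (hp : p.Prime) (v w : HeightOneSpectrum (𝓞 F)) (hvw : w ≠ v)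
    (hv : ((p : ℕ) : 𝓞 F) ∈ v.asIdeal) (hw : ((p : ℕ) : 𝓞 F) ∈ w.asIdeal) :
    v.residueCard = p ∧ ¬ v.asIdeal ^ 2 ∣ Ideal.span {((p : ℕ) : 𝓞 F)} := by
  have h2 : Module.finrank ℚ F = 2 := Algebra.IsQuadraticExtension.finrank_eq_two ℚ F
  have hmem : ∀ u : HeightOneSpectrum (𝓞 F), ((p : ℕ) : 𝓞 F) ∈ u.asIdeal →
      u.asIdeal ∈ (Ideal.span {(p : ℤ)}).primesOver (𝓞 F) := fun u hu =>
    ⟨u.isPrime, liesOver_span_of_natCast_mem_asIdeal hp u hu⟩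
  have hle := Literature.NumberTheory.Automorphic.ncard_primesOver_span_le_finrank (F₀ := F) hp
  haveI hmax : (Ideal.span {(p : ℤ)}).IsMaximal :=
    ((Ideal.span_singleton_prime (by exact_mod_cast hp.ne_zero)).mpr
      (Nat.prime_iff_prime_int.mp hp)).isMaximal
        (by rw [ne_eq, Ideal.span_singleton_eq_bot]; exact_mod_cast hp.ne_zero)
  have hfin : ((Ideal.span {(p : ℤ)}).primesOver (𝓞 F)).Finite :=
    IsDedekindDomain.primesOver_finite _ _
  have hlt : 1 < ((Ideal.span {(p : ℤ)}).primesOver (𝓞 F)).ncard :=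
    (Set.one_lt_ncard_iff hfin).2 ⟨v.asIdeal, w.asIdeal, hmem v hv, hmem w hw,
      fun h => hvw (HeightOneSpectrum.ext h).symm⟩
  have hcard : ((Ideal.span {(p : ℤ)}).primesOver (𝓞 F)).ncard = 2 := by omega
  have hsplit := splitsCompletely_of_ncard_primesOver_eq_two h2 hp hcard
  exact ⟨hsplit.2 v hv, not_sq_dvd_span_of_isUnramifiedIn v hp hv hsplit.1⟩

/-- **At a place with a companion above `p` in a quadratic field, `ℚ_p → F_v` is onto for the
`ℚ_p`-structure of THE pinned datum** (which is the canonical one, unconditionally: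
`fontainePstAdicCompletion_algebra_eq_adicCompletionPadicAlgebra`; then
`algebraMap_adicCompletion_surjective_of_split`). [folklore] -/
theorem algebraMap_fontainePst_surjective_of_two_places [Algebra.IsQuadraticExtension ℚ F]
    {p : ℕ} [Fact p.Prime] (v w : HeightOneSpectrum (𝓞 F)) (hvw : w ≠ v)
    (hv : ((p : ℕ) : 𝓞 F) ∈ v.asIdeal) (hw : ((p : ℕ) : 𝓞 F) ∈ w.asIdeal) :
    Function.Surjective
      (@algebraMap ℚ_[p] (v.adicCompletion F) _ _ (fontainePstAdicCompletion v p hv).algebra) := by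
  obtain ⟨hf, he⟩ := residueCard_eq_and_not_sq_dvd_of_two_places (Fact.out) v w hvw hv hw
  rw [fontainePstAdicCompletion_algebra_eq_adicCompletionPadicAlgebra]
  exact Summit.Langlands.Langlands.Theorems.LiftB2CrysSplitP.algebraMap_adicCompletion_surjective_of_split
    v p hv hf he

end Split


/-! ### 2. The invariant-line sector of the stub (unconditional; every weight, every place) -/

section Flag

variable {F : Type} [Field F] [NumberField F] {p : ℕ} [Fact p.Prime]

/-- `F_v/ℚ_p` is finite for the `ℚ_p`-structure of THE pinned datum (the canonical one,
unconditionally: `fontainePstAdicCompletion_algebra_eq_adicCompletionPadicAlgebra`, with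
`finiteDimensional_padic_adicCompletion`). [folklore] -/
theorem finiteDimensional_fontainePstAdicCompletion (v : HeightOneSpectrum (𝓞 F))
    (hv : ((p : ℕ) : 𝓞 F) ∈ v.asIdeal) :
    letI := (fontainePstAdicCompletion v p hv).algebra
    FiniteDimensional ℚ_[p] (v.adicCompletion F) := by
  rw [fontainePstAdicCompletion_algebra_eq_adicCompletionPadicAlgebra]
  exact Literature.NumberTheory.EllipticCurves.ModularForms.finiteDimensional_padic_adicCompletion
    v p hv

/-- **The invariant-line sector of `stub_pdAtSplitPrime`** (indeed for every rank `n`, every number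
field, every place `v ∣ p`, every weight): a `ρ : Γ_F → GL_n(ℚ̄_p)` whose restriction to `Γ_{F_v}`
is crystalline for THE pinned datum and stabilises a complete flag (e.g. ordinary, or reducible for
`n = 2`) is potentially diagonalisable relative to EVERY compatible crystalline extension datum `𝔈`
— BLGGT Lemma 1.4.3 (1), proved in the tree (`blggt2014_lemma_1_4_3_1_holds`), through
`PstCrystallineExtensionData.isPotentiallyDiagonalizable_of_hasInvariantCompleteFlag`.
[cite: BarnetlambEtAl2014, §1.4 Lemma 1.4.3 (1)] -/
theorem pdAtSplitPrime_of_hasInvariantCompleteFlag {n : ℕ} (ρ : FramedGaloisRep F (PadicAlgCl p) n)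
    (v : HeightOneSpectrum (𝓞 F)) (hv : ((p : ℕ) : 𝓞 F) ∈ v.asIdeal)
    (hcris : (fontainePstAdicCompletion v p hv).IsCrystallineFramed (ρ.toLocal v))
    (hflag : FramedRep.HasInvariantCompleteFlag (ρ.toLocal v))
    (𝔈 : PstCrystallineExtensionData (fontainePstAdicCompletion v p hv)) :
    letI := (fontainePstAdicCompletion v p hv).algebra
    IsPotentiallyDiagonalizable 𝔈.𝔅 (ρ.toLocal v) :=
  𝔈.isPotentiallyDiagonalizable_of_hasInvariantCompleteFlag
    (finiteDimensional_fontainePstAdicCompletion v hv) hcris hflag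

/-- **The reducible sector of `stub_pdAtSplitPrime`**: for `n = 2`, "not irreducible" gives an
invariant complete flag (`hasInvariantCompleteFlag_of_not_isIrreducible`, file
`Theorems/WachComponentCensusPD2UnramReducible`). [cite: BarnetlambEtAl2014, §1.4 Lemma 1.4.3 (1)] -/
theorem pdAtSplitPrime_of_not_isIrreducible (ρ : FramedGaloisRep F (PadicAlgCl p) 2)
    (v : HeightOneSpectrum (𝓞 F)) (hv : ((p : ℕ) : 𝓞 F) ∈ v.asIdeal)
    (hcris : (fontainePstAdicCompletion v p hv).IsCrystallineFramed (ρ.toLocal v))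
    (hred : ¬ FramedRep.IsIrreducible (ρ.toLocal v))
    (𝔈 : PstCrystallineExtensionData (fontainePstAdicCompletion v p hv)) :
    letI := (fontainePstAdicCompletion v p hv).algebra
    IsPotentiallyDiagonalizable 𝔈.𝔅 (ρ.toLocal v) :=
  pdAtSplitPrime_of_hasInvariantCompleteFlag ρ v hv hcris
    (Summit.Langlands.Langlands.Theorems.hasInvariantCompleteFlag_of_not_isIrreducible _ hred) 𝔈

end Flag

/-! ### 3. The range sectors: the stub with one extra conjunct on the gap, conditional on the
named facts `blggt2014_lemma_1_4_3_2` (gap `≤ p − 2`) / `gaoLiu2014_mainTheorem` (gap `≤ p − 1`) -/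

section Range

/-- **The range argument of `stub_pdAtSplitPrime`, for an interval of length `m`.**  Suppose that,
for the prime `p`, every crystalline representation of an absolutely unramified finite `K/ℚ_p`
whose labelled Hodge–Tate weights lie, label by label, in an interval of length `m` is potentially
diagonalisable (`hfact`; for `m = p − 2` this is the named fact `blggt2014_lemma_1_4_3_2` at `p`,
for `m = p − 1` Gao–Liu's `gaoLiu2014_mainTheorem` at `p`).  Then the registered signature of
`stub_pdAtSplitPrime` holds with the one extra conjunct `b - a ≤ m` in its weight clause: two
places above `p` in the quadratic `F` make `ℚ_p → F_v` onto for the datum's `ℚ_p`-structure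
(`algebraMap_fontainePst_surjective_of_two_places`), and the tree's
`PstCrystallineExtensionData.isPotentiallyDiagonalizable_of_weightsInRange_of_surjective`
(file `PstCrystallineExtensionDataFLRange`, landed for this stub) does the weight bookkeeping
(`F₀ = ⊤`, base labels, `labelledHodgeTateWeights_bot_eq`, empty weights at non-`ℚ_p`-linear
labels). [cite: BarnetlambEtAl2014, §1.4 Lemma 1.4.3 (2)] [cite: GaoLiu2014, Thm. 3.0.3] -/
theorem pdAtSplitPrime_of_range (p : ℕ) [Fact p.Prime] (m : ℕ)
    (hfact : ∀ (K : Type) [Field K] [Algebra ℚ_[p] K] [FiniteDimensional ℚ_[p] K]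
      (𝔅 : CrystallineExtensionData.{0, 0} p K) (n : ℕ) (ρ : FramedGaloisRep K (PadicAlgCl p) n),
      IsAbsolutelyUnramified p K →
      IsCrystallineFn (𝔅 ⊥ inferInstance)
        (ρ.restrictField (⊥ : IntermediateField K (AlgebraicClosure K))).matrixFn →
      (∀ τ : (𝔅 ⊥ inferInstance).F₀ →+* PadicAlgCl p, ∃ a : ℤ,
        ∀ h ∈ (𝔅 ⊥ inferInstance).toPeriodRingData.labelledHodgeTateWeights
            (ρ.restrictField (⊥ : IntermediateField K (AlgebraicClosure K))).toGaloisRep τ,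
          a ≤ h ∧ h ≤ a + m) →
      IsPotentiallyDiagonalizable 𝔅 ρ) :
    ∀ (F : Type) [Field F] [NumberField F] [Algebra.IsQuadraticExtension ℚ F],
    ∀ (ρ : FramedGaloisRep F (PadicAlgCl p) 2)
    (v : IsDedekindDomain.HeightOneSpectrum (NumberField.RingOfIntegers F))
    (hv : ((p : ℕ) : NumberField.RingOfIntegers F) ∈ v.asIdeal),
    (∃ w : IsDedekindDomain.HeightOneSpectrum (NumberField.RingOfIntegers F), w ≠ v ∧
      ((p : ℕ) : NumberField.RingOfIntegers F) ∈ w.asIdeal) →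
    (Literature.NumberTheory.PAdicHodge.fontainePstAdicCompletion v p hv).IsCrystallineFramed (ρ.toLocal v) →
    (letI := (Literature.NumberTheory.PAdicHodge.fontainePstAdicCompletion v p hv).algebra
     ∀ τ : v.adicCompletion F →ₐ[ℚ_[p]] PadicAlgCl p, ∃ a b : ℤ, a < b ∧ b - a ≤ m ∧
      ρ.labelledHodgeTateWeightsAt v
        (Literature.NumberTheory.PAdicHodge.fontainePstAdicCompletion v p hv).algebra
        (Literature.NumberTheory.PAdicHodge.fontainePstAdicCompletion v p hv).𝔅 τ.toRingHom = {a, b}) →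
    ∀ 𝔈 : PstCrystallineExtensionData (Literature.NumberTheory.PAdicHodge.fontainePstAdicCompletion v p hv),
    letI := (Literature.NumberTheory.PAdicHodge.fontainePstAdicCompletion v p hv).algebra
    IsPotentiallyDiagonalizable 𝔈.𝔅 (ρ.toLocal v) := by
  intro F _ _ _ ρ v hv hsplit hcris hHT 𝔈
  obtain ⟨w, hwv, hw⟩ := hsplit
  letI := (fontainePstAdicCompletion v p hv).algebra
  refine 𝔈.isPotentiallyDiagonalizable_of_weightsInRange_of_surjective
    (algebraMap_fontainePst_surjective_of_two_places v w hwv hv hw) m hfact hcris fun τ => ?_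
  obtain ⟨a, b, hab, hgap, hwts⟩ := hHT τ
  refine ⟨a, fun h hh => ?_⟩
  have hwts' : (fontainePstAdicCompletion v p hv).𝔅.labelledHodgeTateWeights
      (ρ.toLocal v).toGaloisRep τ.toRingHom = {a, b} := hwts
  rw [hwts'] at hh
  simp only [Multiset.insert_eq_cons, Multiset.mem_cons, Multiset.mem_singleton] at hh
  rcases hh with rfl | rfl <;> constructor <;> omega

/-- **`stub_pdAtSplitPrime` in the Fontaine–Laffaille range (gap `≤ p − 2`), conditional on BLGGT
Lemma 1.4.3 (2).**  The registered signature VERBATIM with the one extra conjunct `b - a + 2 ≤ p`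
in the weight clause, under the tree's named fact `blggt2014_lemma_1_4_3_2` (file
`PotentialDiagonalizabilityFontaineLaffaille`): `pdAtSplitPrime_of_range` with `m = p − 2`.
[cite: BarnetlambEtAl2014, §1.4 Lemma 1.4.3 (2)] -/
theorem pdAtSplitPrime_of_gap_le (hFL : blggt2014_lemma_1_4_3_2.{0}) :
    ∀ (F : Type) [Field F] [NumberField F] [Algebra.IsQuadraticExtension ℚ F] (p : ℕ) [Fact p.Prime],
    11 ≤ p → ∀ (ρ : FramedGaloisRep F (PadicAlgCl p) 2)
    (v : IsDedekindDomain.HeightOneSpectrum (NumberField.RingOfIntegers F))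
    (hv : ((p : ℕ) : NumberField.RingOfIntegers F) ∈ v.asIdeal),
    (∃ w : IsDedekindDomain.HeightOneSpectrum (NumberField.RingOfIntegers F), w ≠ v ∧
      ((p : ℕ) : NumberField.RingOfIntegers F) ∈ w.asIdeal) →
    (Literature.NumberTheory.PAdicHodge.fontainePstAdicCompletion v p hv).IsCrystallineFramed (ρ.toLocal v) →
    (letI := (Literature.NumberTheory.PAdicHodge.fontainePstAdicCompletion v p hv).algebra
     ∀ τ : v.adicCompletion F →ₐ[ℚ_[p]] PadicAlgCl p, ∃ a b : ℤ, a < b ∧ b - a + 2 ≤ p ∧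
      ρ.labelledHodgeTateWeightsAt v
        (Literature.NumberTheory.PAdicHodge.fontainePstAdicCompletion v p hv).algebra
        (Literature.NumberTheory.PAdicHodge.fontainePstAdicCompletion v p hv).𝔅 τ.toRingHom = {a, b}) →
    ∀ 𝔈 : PstCrystallineExtensionData (Literature.NumberTheory.PAdicHodge.fontainePstAdicCompletion v p hv),
    letI := (Literature.NumberTheory.PAdicHodge.fontainePstAdicCompletion v p hv).algebra
    IsPotentiallyDiagonalizable 𝔈.𝔅 (ρ.toLocal v) := by
  intro F _ _ _ p _ hp ρ v hv hsplit hcris hHT 𝔈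
  refine pdAtSplitPrime_of_range p (p - 2) (fun K _ _ _ 𝔅 n r h1 h2 h3 => hFL p K 𝔅 n r h1 h2 h3)
    F ρ v hv hsplit hcris (fun τ => ?_) 𝔈
  obtain ⟨a, b, hab, hgap, hw⟩ := hHT τ
  exact ⟨a, b, hab, by omega, hw⟩

/-- **`stub_pdAtSplitPrime` in Gao–Liu's range (gap `≤ p − 1`), conditional on Gao–Liu 2014,
Thm. 3.0.3.**  The registered signature VERBATIM with the one extra conjunct `b - a + 1 ≤ p` in the
weight clause, under the tree's named fact `gaoLiu2014_mainTheorem` (file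
`PotentialDiagonalizabilityGaoLiu`, landed for this stub): `pdAtSplitPrime_of_range` with
`m = p − 1`. [cite: GaoLiu2014, Thm. 3.0.3] -/
theorem pdAtSplitPrime_of_gap_lt (hGL : gaoLiu2014_mainTheorem.{0}) :
    ∀ (F : Type) [Field F] [NumberField F] [Algebra.IsQuadraticExtension ℚ F] (p : ℕ) [Fact p.Prime],
    11 ≤ p → ∀ (ρ : FramedGaloisRep F (PadicAlgCl p) 2)
    (v : IsDedekindDomain.HeightOneSpectrum (NumberField.RingOfIntegers F))
    (hv : ((p : ℕ) : NumberField.RingOfIntegers F) ∈ v.asIdeal),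
    (∃ w : IsDedekindDomain.HeightOneSpectrum (NumberField.RingOfIntegers F), w ≠ v ∧
      ((p : ℕ) : NumberField.RingOfIntegers F) ∈ w.asIdeal) →
    (Literature.NumberTheory.PAdicHodge.fontainePstAdicCompletion v p hv).IsCrystallineFramed (ρ.toLocal v) →
    (letI := (Literature.NumberTheory.PAdicHodge.fontainePstAdicCompletion v p hv).algebra
     ∀ τ : v.adicCompletion F →ₐ[ℚ_[p]] PadicAlgCl p, ∃ a b : ℤ, a < b ∧ b - a + 1 ≤ p ∧
      ρ.labelledHodgeTateWeightsAt v
        (Literature.NumberTheory.PAdicHodge.fontainePstAdicCompletion v p hv).algebra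
        (Literature.NumberTheory.PAdicHodge.fontainePstAdicCompletion v p hv).𝔅 τ.toRingHom = {a, b}) →
    ∀ 𝔈 : PstCrystallineExtensionData (Literature.NumberTheory.PAdicHodge.fontainePstAdicCompletion v p hv),
    letI := (Literature.NumberTheory.PAdicHodge.fontainePstAdicCompletion v p hv).algebra
    IsPotentiallyDiagonalizable 𝔈.𝔅 (ρ.toLocal v) := by
  intro F _ _ _ p _ hp ρ v hv hsplit hcris hHT 𝔈
  refine pdAtSplitPrime_of_range p (p - 1) (fun K _ _ _ 𝔅 n r h1 h2 h3 => hGL p K 𝔅 n r h1 h2 h3)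
    F ρ v hv hsplit hcris (fun τ => ?_) 𝔈
  obtain ⟨a, b, hab, hgap, hw⟩ := hHT τ
  exact ⟨a, b, hab, by omega, hw⟩

end Range


/-! ### 4. The registered stub 2-small (skeleton v4) -/

/-- **STUB 2-small of skeleton v4 (registered signature, verbatim): potential diagonalisability at a
split prime for Hodge–Tate gap `≤ p − 1`, from Gao–Liu's theorem as its leading hypothesis.**  Pure
repackaging of `pdAtSplitPrime_of_gap_lt`. [cite: GaoLiu2014, Thm. 3.0.3] -/
theorem stub_pdAtSplitPrime_small :
    gaoLiu2014_mainTheorem.{0} →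
    ∀ (F : Type) [Field F] [NumberField F] [Algebra.IsQuadraticExtension ℚ F] (p : ℕ) [Fact p.Prime],
    11 ≤ p → ∀ (ρ : FramedGaloisRep F (PadicAlgCl p) 2)
    (v : IsDedekindDomain.HeightOneSpectrum (NumberField.RingOfIntegers F))
    (hv : ((p : ℕ) : NumberField.RingOfIntegers F) ∈ v.asIdeal),
    (∃ w : IsDedekindDomain.HeightOneSpectrum (NumberField.RingOfIntegers F), w ≠ v ∧
      ((p : ℕ) : NumberField.RingOfIntegers F) ∈ w.asIdeal) →
    (Literature.NumberTheory.PAdicHodge.fontainePstAdicCompletion v p hv).IsCrystallineFramed (ρ.toLocal v) →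
    (letI := (Literature.NumberTheory.PAdicHodge.fontainePstAdicCompletion v p hv).algebra
     ∀ τ : v.adicCompletion F →ₐ[ℚ_[p]] PadicAlgCl p, ∃ a b : ℤ, a < b ∧ b - a + 1 ≤ p ∧
      ρ.labelledHodgeTateWeightsAt v
        (Literature.NumberTheory.PAdicHodge.fontainePstAdicCompletion v p hv).algebra
        (Literature.NumberTheory.PAdicHodge.fontainePstAdicCompletion v p hv).𝔅 τ.toRingHom = {a, b}) →
    ∀ 𝔈 : PstCrystallineExtensionData (Literature.NumberTheory.PAdicHodge.fontainePstAdicCompletion v p hv),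
    letI := (Literature.NumberTheory.PAdicHodge.fontainePstAdicCompletion v p hv).algebra
    IsPotentiallyDiagonalizable 𝔈.𝔅 (ρ.toLocal v) :=
  fun hGL => pdAtSplitPrime_of_gap_lt hGL

end Summit.Langlands.Langlands.Cruxes.TwistedInductionParallel.SymmetrisePdSplit
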